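import Summits.RiemannHypothesis.RiemannHypothesis.Theorems.MotivicDoorFunctionFieldExponent
import Summits.RiemannHypothesis.RiemannHypothesis.Theorems.MotivicDoorFunctionFieldHonest
import Summits.RiemannHypothesis.RiemannHypothesis.Theorems.MotivicDoorFfFibreLattice

/-!
# The function-field door (FF-DOOR, statement (ii)), exact form — part 3: irreducible data, the twin
# pair `x² - t x + t²`, and the geometric fibre of a window prefix
(pub-rhdoor, seat ff-2, gen 3; HONEST FRAMING: lottery ticket at the motivic door; RH probability
negligible; consolation prizes are real: a new semi-local Weil-positivity theorem, or a located gap in the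
Connes–Consani programme, plus the ff-door theorem.  Nothing in this file is a statement about `ζ`.)

Setting and named hypotheses as in parts 1–2 (`MotivicDoorFunctionFieldPeriods`, `…Exponent`):
`hW`, `hHT` (`AbelianVarietyHondaTate`), `hT : tateSimpleRigidity K`, `hPW : frobCharpolyProdSimple K`
(`AbelianVarietyTateSimpleCharpoly`).  Each theorem names exactly the hypotheses it uses.

PROVED here (kernel; labels per item):
* `isFrobCharpoly_pow_irreducible_iff_period_dvd` — for a monic IRREDUCIBLE `m` with Honda–Tate period
  `e` and `E ≥ 1`: `m^E` is geometric over `K` `↔ e ∣ E`: the admissible exponents of an irreducible Weil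
  polynomial are exactly the multiples of its period.  [PROVED from hT, hPW; (⇐) alone needs nothing]
* `irreducible_traceSq` — `x² - t x + t²` is irreducible in `ℤ[X]` for every `t ≥ 1` (no integer root:
  `4(a² - t a + t²) = (2a - t)² + 3t² > 0`).  [PROVED]
* `natCard_eq_of_isHTPeriod_traceSq` — if `x² - t x + t²` has a Honda–Tate period over `K` then
  `#K = t²` (Weil: its roots have absolute value `t`).  [PROVED from hW]
  `exists_isHTPeriod_traceSq` — conversely over a field with `t²` elements it has one.  [PROVED from hHT]
* `traceSq_pow_geometric_iff_period_dvd` — over `K` (necessarily `#K = t²`), with period `e`: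
  `(x² - t x + t²)^E` is geometric `↔ e ∣ E`.  [PROVED from hT, hPW]
* `twin49_of_period_two` — the twin datum `(49, x² - 7x + 49)` of `PfPersistenceFfAngleTwin`: IF its
  period is `2` — this value is DATA / cited, not formalised (Waterhouse 1969 Thm. 4.1: `β = 7 = √q` is
  excluded over `𝔽_49` since `(β, p) ≠ 1` and `7 ≡ 1 (mod 3)`; Honda–Tate invariants `1/2, 1/2` at the two
  primes of `ℚ(√-3)` above `7`) — THEN `x² - 7x + 49` is the characteristic polynomial of Frobenius of NO
  abelian variety over `K`, and `(x² - 7x + 49)^E` is one iff `E` is even.  [PROVED from hT, hPW, modulo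
  the explicit period hypothesis]  `twin4_of_period_one` — for `(4, x² - 2x + 4)` with period `1` (DATA:
  isogeny class 1.4.ac) every power is geometric.  [PROVED, no named fact]  The two towers coincide
  (`PfPersistence.FfAngleTwin.windowForm_4_49`): the window route cannot see the difference.
* `fibre_density_geometric` — ff-1's exact-fibre density (`ffDoor_fibre_density`, part 5b) composed with
  `geo_hlarge` (part 3): for every window-local reader `Φ` of depth `M` accepting all characteristic
  polynomials of Frobenius over `K`, there is a GENUINE datum `P_C` of dimension `g ≥ M + 1` whose depth-`M`
  window is shared by INFINITELY many honest RH-false data of the same dimension, all accepted by `Φ`.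
  [PROVED from hHT]
-/

set_option linter.dupNamespace false  -- the mandated namespace repeats `RiemannHypothesis`

open Polynomial

namespace Summit.RiemannHypothesis.RiemannHypothesis.Theorems.MotivicDoor.FunctionField

open Literature.AlgebraicGeometry.Motives
open Summit.RiemannHypothesis.RiemannHypothesis.Theorems.PfPersistence.FfAngleTwin

universe u

variable {K : Type u} [Field K] [Finite K]

/-! ### Irreducible data: admissible exponents = multiples of the period -/

/-- **Admissible exponents of an irreducible Weil polynomial.**  For `m ∈ ℤ[X]` monic irreducible with
Honda–Tate period `e` and `E ≥ 1`: `m^E` is the characteristic polynomial of the Frobenius of an abelian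
variety over `K` iff `e ∣ E` (`mult_m(m) = 1` in the exact exponent theorem). [PROVED from hT, hPW] -/
theorem isFrobCharpoly_pow_irreducible_iff_period_dvd (hT : AbelianVariety.tateSimpleRigidity K)
    (hPW : AbelianVariety.frobCharpolyProdSimple K) {m : ℤ[X]} (hm : m.Monic) (hirr : Irreducible m)
    {e : ℕ} (he : IsHTPeriod K m e) {E : ℕ} (hE : 0 < E) :
    (∃ C : AbelianVariety K, C.IsFrobCharpoly (m ^ E)) ↔ e ∣ E := by
  have hmdeg : 0 < m.natDegree := hm.natDegree_pos.2 hirr.ne_one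
  have hef : ∀ m' : ℤ[X], m'.Monic → Irreducible m' → m' ∣ m → IsHTPeriod K m' ((fun _ => e) m') := by
    intro m' hm' hirr' hd
    rw [eq_of_monic_irreducible_dvd hm hirr hm' hirr' hd]
    exact he
  rw [isFrobCharpoly_pow_iff_forall_period_dvd hT hPW hm hmdeg hef hE]
  constructor
  · intro H
    have := H m hm hirr dvd_rfl
    rwa [multiplicity_self, mul_one] at this
  · intro H m' hm' hirr' hd
    rw [eq_of_monic_irreducible_dvd hm hirr hm' hirr' hd, multiplicity_self, mul_one]
    exact H

/-- The `(⇐)` half alone needs no named fact: multiples of a period are admissible. [PROVED] -/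
theorem isFrobCharpoly_pow_of_period_dvd {m : ℤ[X]} {e : ℕ} (he : IsHTPeriod K m e) {E : ℕ} (hE : 0 < E)
    (hdvd : e ∣ E) : ∃ C : AbelianVariety K, C.IsFrobCharpoly (m ^ E) := by
  obtain ⟨he0, A, -, hA⟩ := he
  obtain ⟨c, rfl⟩ := hdvd
  have hc : 0 < c := Nat.pos_of_ne_zero (by rintro rfl; simp at hE)
  obtain ⟨C, hC⟩ := AbelianVariety.exists_isFrobCharpoly_pow hA hc
  exact ⟨C, by rwa [pow_mul]⟩

/-! ### The twin polynomials `x² - t x + t²` -/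

omit [Finite K] in
/-- `x² - t x + t²` is irreducible in `ℤ[X]` for `t ≥ 1`: a monic quadratic with no integer root
(`4(a² - t a + t²) = (2a - t)² + 3t² > 0`). [PROVED] -/
theorem irreducible_traceSq {t : ℕ} (ht : 0 < t) :
    Irreducible (X ^ 2 - C (t : ℤ) * X + C ((t : ℤ) ^ 2) : ℤ[X]) := by
  rw [(monic_traceSq t).irreducible_iff_roots_eq_zero_of_degree_le_three
    (by rw [natDegree_traceSq]) (by rw [natDegree_traceSq]; norm_num)]
  refine Multiset.eq_zero_of_forall_notMem fun a ha => ?_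
  rw [Polynomial.mem_roots (monic_traceSq t).ne_zero] at ha
  have h : a ^ 2 - (t : ℤ) * a + (t : ℤ) ^ 2 = 0 := by
    simpa using ha
  have ht' : (0 : ℤ) < t := by exact_mod_cast ht
  nlinarith [sq_nonneg (2 * a - (t : ℤ)), mul_pos ht' ht']

/-- If `x² - t x + t²` has a Honda–Tate period over `K` then `#K = t²`: its complex roots have absolute
value `t` (`frobRoots_norm_eq_of_traceSq`) and, by Weil, absolute value `√#K`. [PROVED from hW] -/
theorem natCard_eq_of_isHTPeriod_traceSq (hW : ∀ A : AbelianVariety K, A.weilRiemannHypothesis) {t e : ℕ}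
    (he : IsHTPeriod K (X ^ 2 - C (t : ℤ) * X + C ((t : ℤ) ^ 2)) e) : Nat.card K = t ^ 2 := by
  have hRH := he.rh hW
  -- pick a root
  have hne : ((X ^ 2 - C (t : ℤ) * X + C ((t : ℤ) ^ 2) : ℤ[X]).map (Int.castRingHom ℂ)) ≠ 0 :=
    ((monic_traceSq t).map _).ne_zero
  have hdeg' : 0 < ((X ^ 2 - C (t : ℤ) * X + C ((t : ℤ) ^ 2) : ℤ[X]).map (Int.castRingHom ℂ)).degree := by
    rw [← Polynomial.natDegree_pos_iff_degree_pos,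
      Polynomial.natDegree_map_eq_of_injective (RingHom.injective_int _), natDegree_traceSq]
    exact two_pos
  obtain ⟨α, hα⟩ := Complex.exists_root hdeg'
  have hmem : α ∈ frobRoots (X ^ 2 - C (t : ℤ) * X + C ((t : ℤ) ^ 2)) :=
    (Polynomial.mem_roots hne).2 hα
  have h1 := frobRoots_norm_eq_of_traceSq t α hmem
  have h2 := hRH α hmem
  rw [h1] at h2
  -- `t = √#K`
  have h3 : (t : ℝ) ^ 2 = (Nat.card K : ℝ) := by
    rw [h2, Real.sq_sqrt (Nat.cast_nonneg _)]
  exact_mod_cast h3.symm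

/-- Over a field with `t²` elements (`t ≥ 1`), `x² - t x + t²` has a Honda–Tate period. [PROVED from hHT] -/
theorem exists_isHTPeriod_traceSq (hHT : AbelianVariety.hondaTateExistence K) {t : ℕ} (ht : 0 < t)
    (hK : Nat.card K = t ^ 2) : ∃ e : ℕ, IsHTPeriod K (X ^ 2 - C (t : ℤ) * X + C ((t : ℤ) ^ 2)) e := by
  refine exists_isHTPeriod_of_rh hHT (monic_traceSq t) (irreducible_traceSq ht) ?_
  intro α hα
  rw [frobRoots_norm_eq_of_traceSq t α hα, hK]
  push_cast
  exact (Real.sqrt_sq (Nat.cast_nonneg _)).symm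

/-- **The twin polynomials through the exact door.**  With period `e` of `x² - t x + t²` over `K`
(`t ≥ 1`) and `E ≥ 1`: `(x² - t x + t²)^E` is the characteristic polynomial of the Frobenius of an abelian
variety over `K` iff `e ∣ E`. [PROVED from hT, hPW] -/
theorem traceSq_pow_geometric_iff_period_dvd (hT : AbelianVariety.tateSimpleRigidity K)
    (hPW : AbelianVariety.frobCharpolyProdSimple K) {t : ℕ} (ht : 0 < t) {e : ℕ}
    (he : IsHTPeriod K (X ^ 2 - C (t : ℤ) * X + C ((t : ℤ) ^ 2)) e) {E : ℕ} (hE : 0 < E) :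
    (∃ B : AbelianVariety K, B.IsFrobCharpoly ((X ^ 2 - C (t : ℤ) * X + C ((t : ℤ) ^ 2)) ^ E)) ↔ e ∣ E :=
  isFrobCharpoly_pow_irreducible_iff_period_dvd hT hPW (monic_traceSq t) (irreducible_traceSq ht) he hE

/-- **`(49, x² - 7x + 49)` given period `2`.**  IF the Honda–Tate period of `x² - 7x + 49` over `K` is `2`
(so `#K = 49`; the value `2` is DATA / cited — Waterhouse 1969 Thm. 4.1 and the Honda–Tate invariants
`1/2, 1/2` of `ℚ(√-3)` above `7` — and enters as an explicit hypothesis), THEN `x² - 7x + 49` is the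
characteristic polynomial of Frobenius of no abelian variety over `K`, while `(x² - 7x + 49)^E` is one
exactly for even `E`. [PROVED from hT, hPW, modulo the explicit period hypothesis] -/
theorem twin49_of_period_two (hT : AbelianVariety.tateSimpleRigidity K)
    (hPW : AbelianVariety.frobCharpolyProdSimple K)
    (h2 : IsHTPeriod K (X ^ 2 - C ((7 : ℕ) : ℤ) * X + C (((7 : ℕ) : ℤ) ^ 2) : ℤ[X]) 2) :
    (¬ ∃ B : AbelianVariety K, B.IsFrobCharpoly (X ^ 2 - C ((7 : ℕ) : ℤ) * X + C (((7 : ℕ) : ℤ) ^ 2))) ∧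
      ∀ E : ℕ, 0 < E →
        ((∃ B : AbelianVariety K, B.IsFrobCharpoly ((X ^ 2 - C ((7 : ℕ) : ℤ) * X + C (((7 : ℕ) : ℤ) ^ 2)) ^ E))
          ↔ 2 ∣ E) := by
  refine ⟨fun H => ?_, fun E hE => traceSq_pow_geometric_iff_period_dvd hT hPW (by norm_num) h2 hE⟩
  have h1 := (traceSq_pow_geometric_iff_period_dvd hT hPW (by norm_num) h2 Nat.one_pos).1
    (by simpa only [pow_one] using H)
  omega

/-- **`(4, x² - 2x + 4)` given period `1`** (DATA: the isogeny class 1.4.ac of elliptic curves over `𝔽_4`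
has this characteristic polynomial; the value enters as an explicit hypothesis): every power
`(x² - 2x + 4)^E`, `E ≥ 1`, is geometric over `K`. [PROVED, no named fact] -/
theorem twin4_of_period_one (h1 : IsHTPeriod K (X ^ 2 - C ((2 : ℕ) : ℤ) * X + C (((2 : ℕ) : ℤ) ^ 2) : ℤ[X]) 1)
    {E : ℕ} (hE : 0 < E) :
    ∃ B : AbelianVariety K, B.IsFrobCharpoly ((X ^ 2 - C ((2 : ℕ) : ℤ) * X + C (((2 : ℕ) : ℤ) ^ 2)) ^ E) :=
  isFrobCharpoly_pow_of_period_dvd h1 hE (one_dvd E)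

/-! ### The geometric fibre of a window prefix (ff-1 part 5b ∘ part 3) -/

/-- **Fibre density for abelian varieties.**  For every window-local reader `Φ` of depth `M` that accepts
every characteristic polynomial of Frobenius over `K` (`q = #K`), there are a dimension `g ≥ M + 1` and a
GENUINE honest datum `h = P_C` of degree `2g` such that infinitely many honest data `h'` of degree `2g`
have the SAME depth-`M` window as `h`, violate `RH(q, h')`, and are accepted by `Φ`.  (ff-1's
`ffDoor_fibre_density` at the geometric witness `geo_hlarge`.) [PROVED from hHT] -/
theorem fibre_density_geometric (hHT : AbelianVariety.hondaTateExistence K) {Φ : Tower → Prop} {M : ℕ}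
    (hloc : ∀ T T' : Tower, (∀ M' ≤ M, T M' = T' M') → Φ T → Φ T')
    (hGeo : ∀ h, (∃ A : AbelianVariety K, A.IsFrobCharpoly h) → Φ (weilWindowTower (Nat.card K : ℝ) h)) :
    ∃ (g : ℕ) (h : ℤ[X]) (C : AbelianVariety K), M + 1 ≤ g ∧ C.IsFrobCharpoly h ∧ h.Monic ∧
      h.natDegree = 2 * g ∧
      {h' : ℤ[X] | h'.Monic ∧ h'.natDegree = 2 * g ∧
        (∀ i j, i + j = 2 * g → (Nat.card K : ℤ) ^ g * h'.coeff j = (Nat.card K : ℤ) ^ i * h'.coeff i) ∧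
        weilWindowForm (Nat.card K : ℝ) h' M = weilWindowForm (Nat.card K : ℝ) h M ∧
        (¬ ∀ α ∈ frobRoots h', ‖α‖ = Real.sqrt (Nat.card K)) ∧
        Φ (weilWindowTower (Nat.card K : ℝ) h')}.Infinite := by
  obtain ⟨g, h, hM, ⟨C, hC⟩, hh, hdeg, hFE⟩ := geo_hlarge hHT M
  exact ⟨g, h, C, hM, hC, hh, hdeg,
    ffDoor_fibre_density hloc (Nat.card_pos (α := K)) hM hh hdeg hFE (hGeo h ⟨C, hC⟩)⟩

end Summit.RiemannHypothesis.RiemannHypothesis.Theorems.MotivicDoor.FunctionField
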